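import Summits.CriticalPhenomena.PercolationContinuityZ3.Theorems.PercNearOneGluingNoHeavyLowerTailBHKRowApexWiredTransfer
import HarnessLib

/-!
# `NoHeavyLowerTail` (stmt-CriticalPhenomena-4575) — the BHK row for the random-cluster measure WIRED on any block containing the apex

Support file (prover prim-gen-kcluster gen 56; `--supports stmt-CriticalPhenomena-4575`).  No named facts, no sorries, no
definitions.  The three-point BHK row of the lineage's cubic-law programme,

  `φ(a|b|c) · φ(abc ∧ b ↮ c off a) ≤ φ(ac|b) · φ(ab|c)`      ("`q · T_a ≤ u_b · u_c`"),

proved for the FREE edge-parameter random-cluster measure `φ = rcMeasureW w q ∅`, `q ≥ 1`, in `…BHKRowRandomCluster`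
(`PivotalBHK.bhkRow_rcMeasureW`, gen 48), is proved here for `φ = rcMeasureW w q B` with ANY wired block `B ∋ a`
(`bhkRow_rcMeasureW_apexWired`; the gadget-block form `bhkRow_rcMeasureW_gadgetBlock`), together with the underlying two-set
theorem itself — van den Berg–Häggström–Kahn's Thm. 1.4 for the split clusters — for `φ^B`, `a ∈ B`
(`twoSet_negCorrelation_events_apexWired`).  For a wired block NOT containing the apex the row is false (`B = {b,c}` on a star,
KCLUSTER-gen50 §2.3), so `a ∈ B` is the right hypothesis.

PROOF.  Realise the wiring by pendant 2-paths `a – z_v – v` (`v ∈ B ∖ {a}`) with sure (parameter-`1`) pairs on the vertex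
type `V ⊕ Z`: the free measure there, read through the lift `ω ↦ ι(ω) ∪ Γ`, IS `φ^B` (`ApexWired.rcMeasureW_real_gadget`);
deleting the apex makes every `z_v` a pendant vertex, so "`b ↮ c off a`" and the port events "`C^a_b` has a port at `a`
through an old pair" `= {a ↔ b}` are unchanged (`reachable_delVertex_liftCfg_iff`, `exists_inl_port_iff_reachable`);
van den Berg–Häggström–Kahn's Thm. 1.4 for the split clusters of the FREE measure — the tree's
`BHK2006_twoSetConditionalAssociation_rc_splitVertex_negCorrelation_events`, valid for all parameters in `[0,1]`,
in particular for the gadget's `1`s — gives `(Q + U_b + U_c + T_a)·T_a ≤ (U_c + T_a)(U_b + T_a)`, i.e. the row.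

WHY (memo run/shared/lean/prim/prim-gen-kcluster/KCLUSTER-gen56.md).  For a planar graph `G` with `a, b, c` on one face,
exact planar duality `φ_{G,p,q} ↔ φ_{G*,p*,q}` maps the lineage's open S-side row R1 (`t·s_a ≤ u_b·u_c`: "given that `C_a`
separates `b` from `c`, `{a↔b}` and `{a↔c}` are negatively correlated") to THIS row on the arc-split dual, whose three arc
vertices form one wired block containing the apex.  Hence R1 holds for `φ_{p,q}`, `q ≥ 1`, on every planar graph with the
three terminals on a common face (paper corollary; the duality itself is not formalised here).
[cite: VandenbergHaggstromKahn2005, Thm. 1.4 (p. 7), Thm. 2.1 (p. 9)]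
-/

noncomputable section

namespace Summit.CriticalPhenomena.PercolationContinuityZ3.Theorems

namespace PivotalBHK

namespace ApexWired

open Literature.Probability.Percolation Literature.Probability.Percolation.BHK2006
open Literature.Probability.LatticeModels SimpleGraph
open scoped Classical

variable {V Z : Type*}

/-! ### van den Berg–Häggström–Kahn's Thm 1.4 (split clusters) for the apex-wired measure -/

section TwoSet

variable (a : V) (att : Z → V) (ω : BondConfig V)

/-- **The split cluster of `inl '' S` in the lift, read on the old pairs (preimage under `Sym2.map inl`), is the split cluster
of `S` in `ω`.** [this work] -/
theorem preimage_splitCl_liftCfg (S : Set V) :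
    Sym2.map Sum.inl ⁻¹' (splitCl (Sum.inl a) (liftCfg a att ω) (Sum.inl '' S)) = splitCl a ω S := by
  ext e
  rw [Set.mem_preimage, mem_splitCl_iff, mem_splitCl_iff, map_inl_mem_liftCfg_iff]
  induction e using Sym2.inductionOn with
  | hf u v =>
    simp only [Sym2.map_mk, Sym2.mk_isDiag_iff, Sum.inl.injEq, Sym2.mem_iff, Set.mem_image]
    constructor
    · rintro ⟨he, hd, x, hx, s', ⟨s, hs, rfl⟩, hr⟩
      refine ⟨he, hd, ?_⟩
      rcases hx with rfl | rfl
      · exact ⟨u, Or.inl rfl, s, hs, (reachable_delVertex_liftCfg_iff a att ω s u).1 hr⟩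
      · exact ⟨v, Or.inr rfl, s, hs, (reachable_delVertex_liftCfg_iff a att ω s v).1 hr⟩
    · rintro ⟨he, hd, x, hx, s, hs, hr⟩
      refine ⟨he, hd, Sum.inl x, ?_, Sum.inl s, ⟨s, hs, rfl⟩, (reachable_delVertex_liftCfg_iff a att ω s x).2 hr⟩
      rcases hx with rfl | rfl
      · exact Or.inl rfl
      · exact Or.inr rfl

variable [Fintype V] [Fintype Z]

open MeasureTheory in
/-- **Thm. 1.4 for the split clusters under `φ^B_{𝐩,q}` wired on the gadget block `B = {a} ∪ att(Z)`** (event form): for increasing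
predicates `P, Q` of the split clusters `C^a_S, C^a_T` (`a ∉ S ∪ T`) and `D^a = {S ↮ T off a}`,
`φ^B(D^a) · φ^B(D^a ∩ {P(C^a_S)} ∩ {Q(C^a_T)}) ≤ φ^B(D^a ∩ {P(C^a_S)}) · φ^B(D^a ∩ {Q(C^a_T)})`, every `q ≥ 1`.
PROOF: the free-measure theorem on the gadget graph `V ⊕ Z` at the split vertex `inl a` for the predicates `P ∘ projPairs`, `Q ∘ projPairs`,
transferred by `rcMeasureW_real_gadget` and read back by `preimage_splitCl_liftCfg`, `reachable_delVertex_liftCfg_iff`.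
[cite: VandenbergHaggstromKahn2005, Thm. 1.4 (p. 7), Thm. 2.1 (p. 9)] -/
theorem twoSet_negCorrelation_events_gadgetBlock (w : Sym2 V → unitInterval) {q : ℝ} (hq : 1 ≤ q) {S T : Set V}
    (haS : a ∉ S) (haT : a ∉ T) (P Q : Set (Sym2 V) → Prop)
    (hP : ∀ ⦃C C' : Set (Sym2 V)⦄, C ⊆ C' → P C → P C')
    (hQ : ∀ ⦃C C' : Set (Sym2 V)⦄, C ⊆ C' → Q C → Q C') :
    (rcMeasureW w q (gadgetBlock a att)).real
        {ω : BondConfig V | ∀ s ∈ S, ∀ t ∈ T, ¬ (openGraph (delVertex a ω)).Reachable s t} *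
      (rcMeasureW w q (gadgetBlock a att)).real
        ({ω : BondConfig V | ∀ s ∈ S, ∀ t ∈ T, ¬ (openGraph (delVertex a ω)).Reachable s t} ∩
          ({ω | P (splitCl a ω S)} ∩ {ω | Q (splitCl a ω T)})) ≤
    (rcMeasureW w q (gadgetBlock a att)).real
        ({ω : BondConfig V | ∀ s ∈ S, ∀ t ∈ T, ¬ (openGraph (delVertex a ω)).Reachable s t} ∩
          {ω | P (splitCl a ω S)}) *
      (rcMeasureW w q (gadgetBlock a att)).real
        ({ω : BondConfig V | ∀ s ∈ S, ∀ t ∈ T, ¬ (openGraph (delVertex a ω)).Reachable s t} ∩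
          {ω | Q (splitCl a ω T)}) := by
  have hq0 : 0 < q := one_pos.trans_le hq
  have haS' : (Sum.inl a : V ⊕ Z) ∉ Sum.inl '' S := fun ⟨s, hs, h⟩ => haS (Sum.inl_injective h ▸ hs)
  have haT' : (Sum.inl a : V ⊕ Z) ∉ Sum.inl '' T := fun ⟨t, ht, h⟩ => haT (Sum.inl_injective h ▸ ht)
  have key := BHK2006_twoSetConditionalAssociation_rc_splitVertex_negCorrelation_events (gadgetW w a att) hq haS' haT'
    (fun C => P (Sym2.map Sum.inl ⁻¹' C)) (fun C => Q (Sym2.map Sum.inl ⁻¹' C))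
    (fun C C' hCC' h => hP (Set.preimage_mono hCC') h) (fun C C' hCC' h => hQ (Set.preimage_mono hCC') h)
  simp only [rcMeasureW_real_gadget w a att hq0, Set.preimage_inter] at key
  have hD : liftCfg a att ⁻¹' {ω' : BondConfig (V ⊕ Z) | ∀ s ∈ Sum.inl '' S, ∀ t ∈ Sum.inl '' T,
      ¬ (openGraph (delVertex (Sum.inl a) ω')).Reachable s t} =
      {ω : BondConfig V | ∀ s ∈ S, ∀ t ∈ T, ¬ (openGraph (delVertex a ω)).Reachable s t} := by
    ext ω
    simp only [Set.mem_preimage, Set.mem_setOf_eq, Set.forall_mem_image, reachable_delVertex_liftCfg_iff]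
  have hPe : liftCfg a att ⁻¹' {ω' : BondConfig (V ⊕ Z) |
      P (Sym2.map Sum.inl ⁻¹' (splitCl (Sum.inl a) ω' (Sum.inl '' S)))} = {ω | P (splitCl a ω S)} := by
    ext ω
    rw [Set.mem_preimage, Set.mem_setOf_eq, Set.mem_setOf_eq, preimage_splitCl_liftCfg]
  have hQe : liftCfg a att ⁻¹' {ω' : BondConfig (V ⊕ Z) |
      Q (Sym2.map Sum.inl ⁻¹' (splitCl (Sum.inl a) ω' (Sum.inl '' T)))} = {ω | Q (splitCl a ω T)} := by
    ext ω
    rw [Set.mem_preimage, Set.mem_setOf_eq, Set.mem_setOf_eq, preimage_splitCl_liftCfg]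
  rw [hD, hPe, hQe] at key
  exact key

open MeasureTheory in
/-- **Thm. 1.4 for the split clusters under `φ^B_{𝐩,q}`, every wired block `B ∋ a`, every `q ≥ 1`** (event form): given
`{S ↮ T off a}`, increasing events of `C^a_S` and of `C^a_T` are negatively correlated.  (`B = ∅`: the tree's free-measure theorem;
the hypothesis `a ∈ B` cannot be dropped.) [cite: VandenbergHaggstromKahn2005, Thm. 1.4 (p. 7), Thm. 2.1 (p. 9)] -/
theorem twoSet_negCorrelation_events_apexWired (w : Sym2 V → unitInterval) {q : ℝ} (hq : 1 ≤ q) {S T : Set V}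
    (haS : a ∉ S) (haT : a ∉ T) {B : Set V} (haB : a ∈ B) (P Q : Set (Sym2 V) → Prop)
    (hP : ∀ ⦃C C' : Set (Sym2 V)⦄, C ⊆ C' → P C → P C')
    (hQ : ∀ ⦃C C' : Set (Sym2 V)⦄, C ⊆ C' → Q C → Q C') :
    (rcMeasureW w q B).real
        {ω : BondConfig V | ∀ s ∈ S, ∀ t ∈ T, ¬ (openGraph (delVertex a ω)).Reachable s t} *
      (rcMeasureW w q B).real
        ({ω : BondConfig V | ∀ s ∈ S, ∀ t ∈ T, ¬ (openGraph (delVertex a ω)).Reachable s t} ∩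
          ({ω | P (splitCl a ω S)} ∩ {ω | Q (splitCl a ω T)})) ≤
    (rcMeasureW w q B).real
        ({ω : BondConfig V | ∀ s ∈ S, ∀ t ∈ T, ¬ (openGraph (delVertex a ω)).Reachable s t} ∩
          {ω | P (splitCl a ω S)}) *
      (rcMeasureW w q B).real
        ({ω : BondConfig V | ∀ s ∈ S, ∀ t ∈ T, ¬ (openGraph (delVertex a ω)).Reachable s t} ∩
          {ω | Q (splitCl a ω T)}) := by
  haveI : Fintype ↥(B \ {a}) := Fintype.ofFinite _
  have hB : gadgetBlock a (Subtype.val : ↥(B \ {a}) → V) = B := by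
    rw [gadgetBlock, Subtype.range_coe_subtype, Set.setOf_mem_eq, Set.insert_sdiff_singleton,
      Set.insert_eq_of_mem haB]
  have h := twoSet_negCorrelation_events_gadgetBlock a (Subtype.val : ↥(B \ {a}) → V) w hq haS haT P Q hP hQ
  rwa [hB] at h

end TwoSet

/-! ### The BHK row for the apex-wired measure -/

section Row

open MeasureTheory

variable [Fintype V] [Fintype Z]

/-- **BHK row for `φ^B_{𝐩,q}` wired on the gadget block `B = {a} ∪ att(Z)`, every `q ≥ 1`**:
`φ^B(a|b|c) · φ^B(abc ∧ b ↮ c off a) ≤ φ^B(ac|b) · φ^B(ab|c)`.  PROOF: the free measure of the gadget graph on `V ⊕ Z` is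
`φ^B` read through the lift (`rcMeasureW_real_gadget`); apply the split-vertex Thm. 1.4 of van den Berg–Häggström–Kahn for
the free measure (tree: `BHK2006_twoSetConditionalAssociation_rc_splitVertex_negCorrelation_events`, valid for parameters
in `[0,1]` including the gadget's `1`s) at the split vertex `inl a` to the increasing port events "the split cluster of
`inl b` (resp. `inl c`) contains an OLD pair at `inl a`" (`= {a ↔ b}`, `{a ↔ c}` by `exists_inl_port_iff_reachable`), the
conditioning event `{inl b ↮ inl c off inl a} = {b ↮ c off a}` (`reachable_delVertex_liftCfg_iff`); then the cell algebra
of `bhkRow_rcMeasureW`. [this work; cites VandenbergHaggstromKahn2005, Thm. 1.4 (p. 7)] -/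
theorem bhkRow_rcMeasureW_gadgetBlock (w : Sym2 V → unitInterval) {q : ℝ} (hq : 1 ≤ q) {a b c : V}
    (hab : a ≠ b) (hac : a ≠ c) (att : Z → V) :
    (rcMeasureW w q (gadgetBlock a att)).real ((openConn a b)ᶜ ∩ (openConn a c)ᶜ ∩ (openConn b c)ᶜ) *
        (rcMeasureW w q (gadgetBlock a att)).real {ω : BondConfig V | ω ∈ openConn a b ∧ ω ∈ openConn a c ∧
          {e | e ∈ ω ∧ a ∉ e} ∉ openConn b c} ≤
      (rcMeasureW w q (gadgetBlock a att)).real (openConn a c ∩ (openConn a b)ᶜ) *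
        (rcMeasureW w q (gadgetBlock a att)).real (openConn a b ∩ (openConn a c)ᶜ) := by
  have hq0 : 0 < q := one_pos.trans_le hq
  haveI := isProbabilityMeasure_rcMeasureW w hq0 (gadgetBlock a att)
  have hbS : (Sum.inl a : V ⊕ Z) ∉ ({Sum.inl b} : Set (V ⊕ Z)) := fun h =>
    hab (Sum.inl_injective (Set.mem_singleton_iff.1 h))
  have hcT : (Sum.inl a : V ⊕ Z) ∉ ({Sum.inl c} : Set (V ⊕ Z)) := fun h =>
    hac (Sum.inl_injective (Set.mem_singleton_iff.1 h))
  -- Thm. 1.4 for the split clusters of `inl b` and `inl c` in the gadget graph, for the OLD-port events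
  have key := BHK2006_twoSetConditionalAssociation_rc_splitVertex_negCorrelation_events (gadgetW w a att) hq hbS hcT
    (fun C => ∃ e ∈ C, ∃ u : V, e = s(Sum.inl a, Sum.inl u)) (fun C => ∃ e ∈ C, ∃ u : V, e = s(Sum.inl a, Sum.inl u))
    (fun C C' hCC' ⟨e, he, hu⟩ => ⟨e, hCC' he, hu⟩)
    (fun C C' hCC' ⟨e, he, hu⟩ => ⟨e, hCC' he, hu⟩)
  -- transfer to `φ^B` and identify the events
  simp only [rcMeasureW_real_gadget w a att hq0, Set.preimage_inter] at key
  set μ := rcMeasureW w q (gadgetBlock a att) with hμ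
  set D : Set (BondConfig V) := {ω | ¬ (openGraph (delVertex a ω)).Reachable b c} with hD
  have hDpre : liftCfg a att ⁻¹' {ω' : BondConfig (V ⊕ Z) | ∀ s ∈ ({Sum.inl b} : Set (V ⊕ Z)),
      ∀ t ∈ ({Sum.inl c} : Set (V ⊕ Z)), ¬ (openGraph (delVertex (Sum.inl a) ω')).Reachable s t} = D := by
    ext ω
    simp only [Set.mem_preimage, Set.mem_setOf_eq, Set.mem_singleton_iff, forall_eq, hD,
      reachable_delVertex_liftCfg_iff]
  have hAb : liftCfg a att ⁻¹' {ω' : BondConfig (V ⊕ Z) |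
      ∃ e ∈ splitCl (Sum.inl a) ω' {Sum.inl b}, ∃ u : V, e = s(Sum.inl a, Sum.inl u)} = openConn a b := by
    ext ω
    exact exists_inl_port_iff_reachable a att ω hab
  have hAc : liftCfg a att ⁻¹' {ω' : BondConfig (V ⊕ Z) |
      ∃ e ∈ splitCl (Sum.inl a) ω' {Sum.inl c}, ∃ u : V, e = s(Sum.inl a, Sum.inl u)} = openConn a c := by
    ext ω
    exact exists_inl_port_iff_reachable a att ω hac
  rw [hDpre, hAb, hAc] at key
  have hDmem : ∀ ω, ω ∈ D ↔ ¬ (openGraph (delVertex a ω)).Reachable b c := fun ω => Iff.rfl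
  -- from here on: the cell algebra of `bhkRow_rcMeasureW`, verbatim
  set Tset : Set (BondConfig V) := {ω | ω ∈ openConn a b ∧ ω ∈ openConn a c ∧
    {e | e ∈ ω ∧ a ∉ e} ∉ openConn b c} with hTset
  set Q : Set (BondConfig V) := (openConn a b)ᶜ ∩ (openConn a c)ᶜ ∩ (openConn b c)ᶜ with hQ
  set Ub : Set (BondConfig V) := openConn a c ∩ (openConn a b)ᶜ with hUb
  set Uc : Set (BondConfig V) := openConn a b ∩ (openConn a c)ᶜ with hUc
  have hco : ∀ (ω : BondConfig V) (x y : V), ω ∈ openConn x y ↔ (openGraph ω).Reachable x y :=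
    fun _ _ _ => Iff.rfl
  have hUcD : Uc ⊆ D := by
    rintro ω ⟨h1, h2⟩
    rw [hDmem]
    intro h
    exact h2 ((show (openGraph ω).Reachable a b from h1).trans
      (h.mono (openGraph_le (delVertex_subset a ω))))
  have hUbD : Ub ⊆ D := by
    rintro ω ⟨h1, h2⟩
    rw [hDmem]
    intro h
    exact h2 ((show (openGraph ω).Reachable a c from h1).trans
      (h.mono (openGraph_le (delVertex_subset a ω))).symm)
  have e1 : D ∩ (openConn a b ∩ openConn a c) = Tset := by
    ext ω
    simp only [Set.mem_inter_iff, hDmem, hTset, Set.mem_setOf_eq]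
    constructor
    · rintro ⟨h, h1, h2⟩; exact ⟨h1, h2, h⟩
    · rintro ⟨h1, h2, h⟩; exact ⟨h, h1, h2⟩
  have e2 : D ∩ openConn a b = Uc ∪ Tset := by
    ext ω
    simp only [Set.mem_inter_iff, Set.mem_union, hDmem, hTset, hUc, Set.mem_setOf_eq,
      Set.mem_compl_iff]
    constructor
    · rintro ⟨h, h1⟩
      by_cases h2 : ω ∈ openConn a c
      · exact Or.inr ⟨h1, h2, h⟩
      · exact Or.inl ⟨h1, h2⟩
    · rintro (⟨h1, h2⟩ | ⟨h1, h2, h⟩)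
      · exact ⟨(hDmem ω).1 (hUcD ⟨h1, h2⟩), h1⟩
      · exact ⟨h, h1⟩
  have e3 : D ∩ openConn a c = Ub ∪ Tset := by
    ext ω
    simp only [Set.mem_inter_iff, Set.mem_union, hDmem, hTset, hUb, Set.mem_setOf_eq,
      Set.mem_compl_iff]
    constructor
    · rintro ⟨h, h1⟩
      by_cases h2 : ω ∈ openConn a b
      · exact Or.inr ⟨h2, h1, h⟩
      · exact Or.inl ⟨h1, h2⟩
    · rintro (⟨h1, h2⟩ | ⟨h1, h2, h⟩)
      · exact ⟨(hDmem ω).1 (hUbD ⟨h1, h2⟩), h1⟩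
      · exact ⟨h, h2⟩
  have e4 : D \ openConn a b = Ub ∪ Q := by
    ext ω
    simp only [Set.mem_sdiff, Set.mem_union, hDmem, hUb, hQ, Set.mem_inter_iff, Set.mem_compl_iff]
    constructor
    · rintro ⟨h, h1⟩
      by_cases h2 : ω ∈ openConn a c
      · exact Or.inl ⟨h2, h1⟩
      · refine Or.inr ⟨⟨h1, h2⟩, fun h3 => h ?_⟩
        exact reachable_delVertex_of_not_reachable h3 fun h4 => h1 ((hco ω a b).2 h4.symm)
    · rintro (⟨h1, h2⟩ | ⟨⟨h1, h2⟩, h3⟩)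
      · exact ⟨(hDmem ω).1 (hUbD ⟨h1, h2⟩), h2⟩
      · refine ⟨fun h => h3 ?_, h1⟩
        exact h.mono (openGraph_le (delVertex_subset a ω))
  have d2 : Disjoint Uc Tset := Set.disjoint_left.2 fun ω h1 h2 => h1.2 h2.2.1
  have d3 : Disjoint Ub Tset := Set.disjoint_left.2 fun ω h1 h2 => h1.2 h2.1
  have d4 : Disjoint Ub Q := Set.disjoint_left.2 fun ω h1 h2 => h2.1.2 h1.1
  have m2 : μ.real (D ∩ openConn a b) = μ.real Uc + μ.real Tset := by
    rw [e2]; exact measureReal_union d2 (MeasurableSet.of_discrete)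
  have m3 : μ.real (D ∩ openConn a c) = μ.real Ub + μ.real Tset := by
    rw [e3]; exact measureReal_union d3 (MeasurableSet.of_discrete)
  have m4 : μ.real D = μ.real Uc + μ.real Tset + (μ.real Ub + μ.real Q) := by
    rw [← measureReal_inter_add_sdiff (MeasurableSet.of_discrete (s := openConn a b)), m2, e4,
      measureReal_union d4 (MeasurableSet.of_discrete)]
  rw [e1, m2, m3, m4] at key
  have hT : 0 ≤ μ.real Tset := measureReal_nonneg
  have hUb0 : 0 ≤ μ.real Ub := measureReal_nonneg
  have hUc0 : 0 ≤ μ.real Uc := measureReal_nonneg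
  have hQ0 : 0 ≤ μ.real Q := measureReal_nonneg
  nlinarith [key]

/-- **BHK row for `φ^B_{𝐩,q}`, every wired block `B` containing the apex `a`, every `q ≥ 1`**:
`φ^B(a|b|c) · φ^B(abc ∧ b ↮ c off a) ≤ φ^B(ac|b) · φ^B(ab|c)`.  (For `B = ∅` this is `bhkRow_rcMeasureW`; for a block
NOT containing the apex the row fails, e.g. `B = {b,c}` on a star — KCLUSTER-gen50 §2.3.)  By planar duality this is R1
(`t·s_a ≤ u_b·u_c`) for `φ_{p,q}` on every planar graph with the three terminals on one face (memo KCLUSTER-gen56).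
[this work; cites VandenbergHaggstromKahn2005, Thm. 1.4 (p. 7)] -/
theorem bhkRow_rcMeasureW_apexWired (w : Sym2 V → unitInterval) {q : ℝ} (hq : 1 ≤ q) {a b c : V}
    (hab : a ≠ b) (hac : a ≠ c) {B : Set V} (haB : a ∈ B) :
    (rcMeasureW w q B).real ((openConn a b)ᶜ ∩ (openConn a c)ᶜ ∩ (openConn b c)ᶜ) *
        (rcMeasureW w q B).real {ω : BondConfig V | ω ∈ openConn a b ∧ ω ∈ openConn a c ∧
          {e | e ∈ ω ∧ a ∉ e} ∉ openConn b c} ≤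
      (rcMeasureW w q B).real (openConn a c ∩ (openConn a b)ᶜ) *
        (rcMeasureW w q B).real (openConn a b ∩ (openConn a c)ᶜ) := by
  haveI : Fintype ↥(B \ {a}) := Fintype.ofFinite _
  have hB : gadgetBlock a (Subtype.val : ↥(B \ {a}) → V) = B := by
    rw [gadgetBlock, Subtype.range_coe_subtype, Set.setOf_mem_eq, Set.insert_sdiff_singleton,
      Set.insert_eq_of_mem haB]
  have h := bhkRow_rcMeasureW_gadgetBlock w hq hab hac (Subtype.val : ↥(B \ {a}) → V)
  rwa [hB] at h

end Row

end ApexWired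

end PivotalBHK

end Summit.CriticalPhenomena.PercolationContinuityZ3.Theorems

end
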